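import Literature.Probability.RandomPlanarGeometry.SAWStripTMAtBound
import Literature.Probability.RandomPlanarGeometry.SAWStripTMAtEval2604
import Literature.Probability.RandomPlanarGeometry.SAWStripTMAtEval2604b
import Literature.Probability.RandomPlanarGeometry.SAWStripTMAtEval2604c
import Literature.Probability.RandomPlanarGeometry.SAWLowerBound
import Mathlib.Algebra.Field.GeomSum
import HarnessLib

/-!
# `2.604 ≤ μ(ℤ²)`: Kesten's bound from span-limited irreducible bridges at fugacity `1/2.604`

Topic `Literature/Probability/RandomPlanarGeometry` (continues `SAWLowerBound.lean`, which proves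
`2.6 ≤ μ(ℤ²)` at the hard-coded fugacity `5/13`). The same method (Kesten 1963; Alm–Parviainen and
Jensen 2004, §2: irreducible bridges of bounded span counted by transfer matrices, eq. (4)) at the
fugacity `250/651 = 1/2.604` with the parametrised weight layer `StripTM.dpAt` (`SAWStripTMAt.lean`,
soundness `StripTM.kraft_ge_at` in `SAWStripTMAtBound.lean`): the set `S` of irreducible bridges
consisting of the span-1 family of `SAWLowerBound.lean` (Kraft sum `0.862858` at `250/651`) and the
decoded accepted traces of the strip transfer matrices of spans `2, …, 6` in the `81`-row window and of
span `7` in a `33`-row window (compiled values `StripTM.dpAt_two_2604`, …, `StripTM.dpAt_seven_2604`,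
Kraft sum `≥ 0.137270`) has total Kraft sum `≥ 1.000128 ≥ 1`, so
`Renewal.le_connectiveConstant_of_kraft` gives **`le_connectiveConstant_2604 : 2.604 ≤ μ(ℤ²)`**,
improving the tree's `2.6` (`le_connectiveConstant_26`). Printed record: `2.625622` (Jensen 2004, spans
`≤ 15`, lengths `≤ 250` — beyond one kernel evaluation per span: span 7 alone in 33 rows is ≈ 8 min).

## References

* I. Jensen, *Improved lower bounds on the connective constants for two-dimensional self-avoiding
  walks*, J. Phys. A 37 (2004) 11521–11529, §2, eq. (3)–(4) [Jensen2004SAWLowerBounds].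
* H. Kesten, *On the number of self-avoiding walks*, J. Math. Phys. 4 (1963) 960–969.
-/

open Finset Literature.Probability.LatticeModels
open scoped BigOperators

namespace Literature.Probability.RandomPlanarGeometry.SAW

/-- **Kraft sum of the span-1 family** at a general fugacity `x`. [cite: Jensen2004SAWLowerBounds, §2.1] -/
theorem kraft_spanOneFamily_at (x : ℝ) :
    ∑ s ∈ spanOneFamily, x ^ s.length =
      ∑ k ∈ Finset.range 61, x ^ (k + 1) + ∑ k ∈ Finset.range 60, x ^ (k + 2) := by
  rw [spanOneFamily, sum_union, sum_image, sum_image]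
  · simp only [length_vertWord]
  · intro a _ b _ h; have := congrArg List.length h; simp at this; exact this
  · intro a _ b _ h; have := congrArg List.length h; simp at this; exact this
  · rw [Finset.disjoint_left]
    rintro s hs hs'
    rw [mem_image] at hs hs'
    obtain ⟨a, -, rfl⟩ := hs
    obtain ⟨b, -, h⟩ := hs'
    have := congrArg (fun w : List Step => w[1]?) h
    simp [vertWord, List.getElem?_cons_succ] at this
    cases a <;> simp at this

/-- The certified spans and their weighted counts at fugacity `250/651`. [cite: Jensen2004SAWLowerBounds, §2] -/
theorem dpAt_values_2604 :
    (StripTM.dpAt 250 651 2 40 (2 ^ 64) 81 : ℝ) + StripTM.dpAt 250 651 3 40 (2 ^ 64) 81 +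
      StripTM.dpAt 250 651 4 40 (2 ^ 64) 81 + StripTM.dpAt 250 651 5 40 (2 ^ 64) 81 +
      StripTM.dpAt 250 651 6 40 (2 ^ 64) 81 + StripTM.dpAt 250 651 7 16 (2 ^ 64) 33 = 2532187408892569257 := by
  rw [StripTM.dpAt_two_2604, StripTM.dpAt_three_2604, StripTM.dpAt_four_2604, StripTM.dpAt_five_2604,
    StripTM.dpAt_six_2604, StripTM.dpAt_seven_2604]; norm_num

/-- The numerical heart: the total Kraft sum at `250/651` exceeds `1` (it is `1.000128…`).
[cite: Jensen2004SAWLowerBounds, §2] -/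
theorem kraft_numeric_2604 :
    (1 : ℝ) ≤ (∑ k ∈ Finset.range 61, (250 / 651 : ℝ) ^ (k + 1) + ∑ k ∈ Finset.range 60, (250 / 651 : ℝ) ^ (k + 2)) +
      2532187408892569257 / 2 ^ 64 := by
  have h1 : ∑ k ∈ Finset.range 61, (250 / 651 : ℝ) ^ (k + 1) = 250 / 651 * ∑ k ∈ Finset.range 61, (250 / 651 : ℝ) ^ k := by
    rw [mul_sum]; refine sum_congr rfl fun k _ => by ring
  have h2 : ∑ k ∈ Finset.range 60, (250 / 651 : ℝ) ^ (k + 2) = (250 / 651) ^ 2 * ∑ k ∈ Finset.range 60, (250 / 651 : ℝ) ^ k := by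
    rw [mul_sum]; refine sum_congr rfl fun k _ => by ring
  rw [h1, h2, geom_sum_eq (by norm_num), geom_sum_eq (by norm_num)]
  norm_num

/-- **`2.604 ≤ μ(ℤ²)`** (Kesten's irreducible-bridge bound with the span-1 family and the certified
strip transfer matrices of spans 2–7 at fugacity `1/2.604`; cf. Jensen 2004: `2.625622` with spans `≤ 15`).
[cite: Jensen2004SAWLowerBounds, §2, eq. (4)] -/
theorem le_connectiveConstant_2604 : (2.604 : ℝ) ≤ connectiveConstant := by
  have hq : (250 : ℕ) ≤ 651 := by norm_num
  obtain ⟨S2, hS2, hK2⟩ := StripTM.kraft_ge_at (l := 2) (r0 := 40) le_rfl hq (2 ^ 64) 81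
  obtain ⟨S3, hS3, hK3⟩ := StripTM.kraft_ge_at (l := 3) (r0 := 40) (by norm_num) hq (2 ^ 64) 81
  obtain ⟨S4, hS4, hK4⟩ := StripTM.kraft_ge_at (l := 4) (r0 := 40) (by norm_num) hq (2 ^ 64) 81
  obtain ⟨S5, hS5, hK5⟩ := StripTM.kraft_ge_at (l := 5) (r0 := 40) (by norm_num) hq (2 ^ 64) 81
  obtain ⟨S6, hS6, hK6⟩ := StripTM.kraft_ge_at (l := 6) (r0 := 40) (by norm_num) hq (2 ^ 64) 81
  obtain ⟨S7, hS7, hK7⟩ := StripTM.kraft_ge_at (l := 7) (r0 := 16) (by norm_num) hq (2 ^ 64) 33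
  set U := spanOneFamily ∪ S2 ∪ S3 ∪ S4 ∪ S5 ∪ S6 ∪ S7 with hU
  have hadm : Renewal.Admissible U := by
    intro s hs
    simp only [hU, mem_union] at hs
    rcases hs with (((((h | h) | h) | h) | h) | h) | h
    · exact (spanOneFamily_spec s h).1
    · exact (hS2 s h).1
    · exact (hS3 s h).1
    · exact (hS4 s h).1
    · exact (hS5 s h).1
    · exact (hS6 s h).1
    · exact (hS7 s h).1
  have h0 : [(0 : Step)] ∈ U := by
    simp only [hU, mem_union]
    exact Or.inl (Or.inl (Or.inl (Or.inl (Or.inl (Or.inl nil_cons_mem_spanOneFamily)))))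
  -- the Kraft sum splits over the spans
  have hx1 : ∀ s ∈ spanOneFamily, xEnd s < 2 := fun s hs => by rw [(spanOneFamily_spec s hs).2]; norm_num
  have hx2 : ∀ s ∈ spanOneFamily ∪ S2, xEnd s < 3 := fun s hs => by
    rcases mem_union.1 hs with h | h; linarith [hx1 s h]; rw [(hS2 s h).2]; norm_num
  have hx3 : ∀ s ∈ spanOneFamily ∪ S2 ∪ S3, xEnd s < 4 := fun s hs => by
    rcases mem_union.1 hs with h | h; linarith [hx2 s h]; rw [(hS3 s h).2]; norm_num
  have hx4 : ∀ s ∈ spanOneFamily ∪ S2 ∪ S3 ∪ S4, xEnd s < 5 := fun s hs => by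
    rcases mem_union.1 hs with h | h; linarith [hx3 s h]; rw [(hS4 s h).2]; norm_num
  have hx5 : ∀ s ∈ spanOneFamily ∪ S2 ∪ S3 ∪ S4 ∪ S5, xEnd s < 6 := fun s hs => by
    rcases mem_union.1 hs with h | h; linarith [hx4 s h]; rw [(hS5 s h).2]; norm_num
  have hx6 : ∀ s ∈ spanOneFamily ∪ S2 ∪ S3 ∪ S4 ∪ S5 ∪ S6, xEnd s < 7 := fun s hs => by
    rcases mem_union.1 hs with h | h; linarith [hx5 s h]; rw [(hS6 s h).2]; norm_num
  have hsum : ∑ s ∈ U, ((250 : ℕ) / (651 : ℕ) : ℝ) ^ s.length = ∑ s ∈ spanOneFamily, ((250 : ℕ) / (651 : ℕ) : ℝ) ^ s.length +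
      ∑ s ∈ S2, ((250 : ℕ) / (651 : ℕ) : ℝ) ^ s.length + ∑ s ∈ S3, ((250 : ℕ) / (651 : ℕ) : ℝ) ^ s.length +
      ∑ s ∈ S4, ((250 : ℕ) / (651 : ℕ) : ℝ) ^ s.length + ∑ s ∈ S5, ((250 : ℕ) / (651 : ℕ) : ℝ) ^ s.length +
      ∑ s ∈ S6, ((250 : ℕ) / (651 : ℕ) : ℝ) ^ s.length + ∑ s ∈ S7, ((250 : ℕ) / (651 : ℕ) : ℝ) ^ s.length := by
    rw [hU, sum_union_of_xEnd hx6 (fun s h => by exact_mod_cast (hS7 s h).2),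
      sum_union_of_xEnd hx5 (fun s h => by exact_mod_cast (hS6 s h).2),
      sum_union_of_xEnd hx4 (fun s h => by exact_mod_cast (hS5 s h).2),
      sum_union_of_xEnd hx3 (fun s h => by exact_mod_cast (hS4 s h).2),
      sum_union_of_xEnd hx2 (fun s h => by exact_mod_cast (hS3 s h).2),
      sum_union_of_xEnd hx1 (fun s h => by exact_mod_cast (hS2 s h).2)]
  have hK : (1 : ℝ) ≤ ∑ s ∈ U, (651 / 250 : ℝ)⁻¹ ^ s.length := by
    rw [show (651 / 250 : ℝ)⁻¹ = ((250 : ℕ) / (651 : ℕ) : ℝ) by norm_num, hsum]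
    have e1 : ((250 : ℕ) / (651 : ℕ) : ℝ) = 250 / 651 := by norm_num
    rw [e1, kraft_spanOneFamily_at]
    have hS : (((2 : ℕ) ^ 64 : ℕ) : ℝ) = (2 : ℝ) ^ 64 := by norm_num
    rw [hS, e1] at hK2 hK3 hK4 hK5 hK6 hK7
    have hpos : (0 : ℝ) < 2 ^ 64 := by positivity
    have hV := dpAt_values_2604
    have hTot1 : (2532187408892569257 : ℝ) ≤ 2 ^ 64 * (∑ s ∈ S2, (250 / 651 : ℝ) ^ s.length +
        ∑ s ∈ S3, (250 / 651 : ℝ) ^ s.length + ∑ s ∈ S4, (250 / 651 : ℝ) ^ s.length +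
        ∑ s ∈ S5, (250 / 651 : ℝ) ^ s.length + ∑ s ∈ S6, (250 / 651 : ℝ) ^ s.length +
        ∑ s ∈ S7, (250 / 651 : ℝ) ^ s.length) := by
      rw [← hV]; linarith [hK2, hK3, hK4, hK5, hK6, hK7]
    have hTot2 : (2532187408892569257 : ℝ) / 2 ^ 64 ≤ ∑ s ∈ S2, (250 / 651 : ℝ) ^ s.length +
        ∑ s ∈ S3, (250 / 651 : ℝ) ^ s.length + ∑ s ∈ S4, (250 / 651 : ℝ) ^ s.length +
        ∑ s ∈ S5, (250 / 651 : ℝ) ^ s.length + ∑ s ∈ S6, (250 / 651 : ℝ) ^ s.length +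
        ∑ s ∈ S7, (250 / 651 : ℝ) ^ s.length := by
      rw [div_le_iff₀' hpos]; exact hTot1
    have hnum := kraft_numeric_2604
    linarith
  have := Renewal.le_connectiveConstant_of_kraft hadm h0 (ρ := 651 / 250) (by norm_num) hK
  linarith

end Literature.Probability.RandomPlanarGeometry.SAW
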